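import Mathlib.Analysis.SpecificLimits.Basic
import Mathlib.Analysis.Asymptotics.Lemmas
import Literature.Computability.Complexity.Williams2014
import Literature.Computability.Complexity.CNF
import Literature.Computability.Complexity.NSubexp
import Literature.Computability.Complexity.WilliamsBoundConstructible
import Literature.Computability.Complexity.DTIMESubsetNTIME
import Literature.Computability.MetaComplexity.TruthTables
import HarnessLib

/-!
# Williams' transfer theorem for `ACC` (J. ACM 2014, Thm. 1.3): the printed proof, second layer

`Williams2014.lean` reduces the named fact `williams_acc : ¬ (NTIME (2 ^ ·) ⊆ ACC0)`
(`CircuitLowerBounds.lean`; Williams 2014, Thm. 1.1) to two named facts and proves the assembly: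
the *algorithms-to-lower-bounds transfer* `Williams2014_lowerBound_of_accSat` (Thm. 1.3 for the
class `ACC`) and the `ACC`-SAT algorithm `Williams2014_accSat_polysize` (Thm. 4.1). This file
DECOMPOSES the transfer theorem one level further, into the results its printed proof quotes
(Williams 2014, §3 and §5, proof of Thm. 1.1 on pp. 17–18), vendored as named facts over the
tree's model, and PROVES the assembly of Thm. 1.3 from them:

* `Williams2014_fact_3_1` — the **efficient succinct Cook–Levin reduction** (Williams 2014,
  Fact 3.1, in the clause-function form of Thm. 3.3 = Tourlakis 2001 / Fortnow–Lipton–van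
  Melkebeek–Viglas 2005: every `L ∈ NTIME[2ⁿ]` reduces to `3SAT` instances with `2ⁿ · poly(n)`
  clauses whose `i`-th clause is computable from `(x, i)` in `poly(n)` time);
* `Williams2014_thm_5_2` — **universal witness circuits** (Impagliazzo–Kabanets–Wigderson 2002;
  Williams 2014, Thm. 5.2: `NEXP ⊆ P/poly` implies that every language in `NEXP` has universal
  witness circuits of polynomial size), with the notion `HasUniversalWitnessCircuits` over the
  tree's verifier-form `NTIME` (`NVerifier`);
* `Williams2014_thm_5_1` — **succinct satisfying assignments** (Williams 2014, Thm. 5.1, the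
  consequence of Thm. 5.2 used in the proof of Thm. 1.1): under `NEXP ⊆ P/poly` every satisfiable
  formula produced by a succinct reduction has a satisfying assignment encoded by a
  polynomial-size circuit (`HasSuccinctAssignments`);
* `Williams2014_thm_3_2` — the **nondeterministic simulation** (Williams 2014, Thm. 3.2 with the
  guess-and-verify Lemma 3.1, in the polynomial-size form run in the proof of Thm. 1.1, p. 18):
  if `P ⊆ ACC0`, succinct satisfying assignments exist, and `AC⁰[m]`-SAT of polynomial-size
  circuits is decidable in time `O(2ⁿ/nᵏ)` for a suitable `k`, then `L ∈ NTIME[n + 2ⁿ/n]`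
  (`williamsBound`);
* the padding step `NEXP_subset_PPoly_of_NTIME_two_pow_subset`
  (`NTIME(2ⁿ) ⊆ P/poly → NEXP ⊆ P/poly`, p. 17; named fact, a machine construction). The other
  textbook ingredients of p. 17 are theorems of the tree and are USED here, not assumed:
  `P ⊆ NTIME(2ⁿ)` (`P_subset_NTIME_two_pow_thm`, `DTIMESubsetNTIME.lean`, via the truncating
  wrapper of `TruncMapMachine.lean`), the time-constructibility of `williamsBound`
  (`isTimeConstructible_williamsBound` below, from `WilliamsBoundConstructible.lean`) and of `2ⁿ`
  (`NSubexp.lean`); `ACC⁰ ⊆ P/poly` enters as the plain hypothesis `ACC0 ⊆ PPoly`, supplied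
  either by the direct proof `ACC0_subset_PPoly` of `ACC0SubsetPPoly.lean` or by the chain of the
  named facts `ACC0_subset_TC0`, `TC0_subset_NC1` with the theorem `NC1_subset_PPoly`
  (`ACC0_subset_PPoly_of_chain` below);
* **proved**: `Williams2014_lowerBound_of_accSat_of` — the facts above, the nondeterministic
  time hierarchy theorem (`ntime_hierarchy`, `Williams2014.lean`) and `ACC0 ⊆ PPoly` imply
  `Williams2014_lowerBound_of_accSat`, following the proof of Thm. 1.1
  (pp. 17–18): `NTIME(2ⁿ) ⊆ ACC0` gives `P ⊆ ACC0` and `NEXP ⊆ P/poly`, hence (Thm. 5.1) succinct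
  satisfying assignments, hence (Thm. 3.2) `NTIME(2ⁿ) ⊆ NTIME(n + 2ⁿ/n)`, contradicting the
  hierarchy theorem since `(n + 1) + 2ⁿ⁺¹/(n + 1) = o(2ⁿ)` (`isLittleO_williamsBound_succ`,
  proved) and `2ⁿ` is time constructible (`isTimeConstructible_two_pow`, `NSubexp.lean`);
  `williams_acc_of_components` records the complete list of components of Thm. 1.1;
  `NTIME_two_pow_subset_NEXP` records why the `NTIME(2ⁿ)` hypothesis of Thm. 5.1 is harmless.

To state the facts we define: the variable assignment encoded by a circuit
(`Circuit.assignment`: Williams' "`zᵢ = W(i)`", variable `v < 2ᵏ` read at the `v`-th point of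
the Boolean cube in the tree's enumeration `MetaComplexity.boolFunEquivFin`, so that it is the
`v`-th bit of the tree's truth table `MetaComplexity.truthTable W.eval`,
`Circuit.assignment_eq_getElem_truthTable`), succinctly presented `3CNF` formulas given by a
*clause function*
`cl : {0,1}* → ℕ → Clause ℕ` (`succinctWidth`, `succinctCNF`, over the tree's `Clause`/`CNF` of
`CNF.lean`), succinct reductions (`IsSuccinctReduction`), succinct satisfying assignments
(`HasSuccinctAssignments`), verifiers (`NVerifier`, the data of `L ∈ NTIME t`, with
`mem_NTIME_iff_nonempty_nVerifier`) and universal witness circuits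
(`HasUniversalWitnessCircuits`).

## Faithfulness notes

* Fact 3.1 is printed with a circuit `Cₓ` of `O(nᶜ)` size on `n + c log n` inputs whose truth
  table is the formula `F_{Cₓ}`; Williams derives it from Thm. 3.3 (the `i`-th clause of the
  `3SAT` instance of an `NTIME[n]` language is computable in `O((log n)ᶜ)` time with random
  access) by padding: "one can simulate the `O((log n)ᶜ)` time algorithm of Theorem 3.3 on `L'`,
  with a uniform `poly(|x|ᶜ)` size circuit". We vendor the machine content — the clause function
  `(x, i) ↦ clause i` is computable in time `O(ℓᶜ)` on queries `⟨x, bin i⟩` of length `ℓ`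
  (`IsSuccinctReduction.time`, `TimeComputable` over Mathlib's `TM2`; the exponent is the
  universal `c`, the `O`-constant depends on `L`), there are `2 ^ (n + c log₂ n + c) =
  2ⁿ · poly(n)` clauses of width `≤ 3` on variables `< 2 ^ (n + c log₂ n + c)` — from which a
  circuit `Cₓ` of `O(n^{2c})` size is recovered by the tree's `P ⊆ P/poly` (tableau circuits);
  the P-uniformity of `Cₓ` used in Lemma 3.1 is exactly this clause-computing machine (finitely
  many short inputs may be answered by table lookup, which is how an `L`-dependent constant in
  `NTIME (2 ^ ·)` is reconciled with the universal `c`). The source proves Thm. 3.3 for multitape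
  machines; the
  tree's `NTIME` is the verifier form over Mathlib's multi-stack `TM2` (one `TM2` step is `O(1)`
  tape operations per stack, so a `TM2` verifier running in `c · 2ⁿ + c` steps is a multitape
  nondeterministic machine running in `O(2ⁿ)` time; Williams 2014, §2 "On the machine model":
  "the choice of uniform machine model is not crucial").
* Thm. 5.1 is printed for "the circuit `Cₓ` obtained by the reduction in Fact 3.1"; it is derived
  there in one line from Thm. 5.2 (universal witness circuits for EVERY correct exponential-time
  verifier), and that derivation applies verbatim to every succinct reduction in the above sense
  (the verifier "`y` satisfies all clauses `cl x i`, `i < 2 ^ (n + c log₂ n + c)`" is a correct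
  exponential-time verifier for `L`). We therefore state Thm. 5.1 for every succinct reduction
  and vendor Thm. 5.2 itself as the leaf fact; the derivation 5.2 ⟹ 5.1 is a machine
  construction left to the discharge of `Williams2014_thm_5_1`.
* Thm. 3.2 is printed for `E^NP` with `S(n)`-size circuits ("there is a `c > 0` such that, if
  `C`-CIRCUIT SAT instances with at most `n + c log n` variables, depth `2d + O(1)`, and
  `O(n S(2n) + S(3n))` size can be solved in `O(2ⁿ/nᶜ)` time, then `E^NP` does not have
  non-uniform `C` circuits of depth `d` and `S(n)` size"); its proof shows
  `NTIME[2ⁿ] ⊆ NTIME[o(2ⁿ)]` under the assumptions, using the full assumption only through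
  Fact 3.2 (succinct satisfying assignments), and the proof of Thm. 1.1 (p. 18) reruns it with
  the polynomial-size witnesses of Thm. 5.1: "Hence the `ACC` CIRCUIT SAT instance `D`
  constructed in Theorem 3.2 with the witness circuit `W` has size polynomial in its `n + c log n`
  inputs … unsatisfiability of `D` can be determined in `O(2ⁿ/nᶜ)` time for every constant `c`".
  We vendor exactly this rerun: hypotheses `P ⊆ ACC0` (for Lemma 3.1 and Lemma 5.1), succinct
  satisfying assignments, and `AC⁰[m]`-SAT in `O(2ⁿ/nᵏ)` for all depths, moduli and polynomial
  sizes (`AccSatInTime`, `Williams2014.lean`); conclusion `L ∈ NTIME (n + 2ⁿ/n)` — the printed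
  "`O(2ⁿ n¹⁰/nᵏ)` … when `k > 10`" with the exponent `k` existentially quantified after the
  constant `c` of the reduction (three SAT calls on circuits with `n + 2c log₂ n + O(1)` inputs
  cost `O(2ⁿ n^{2c + O(1)}/nᵏ) ≤ 2ⁿ/n` for `k ≥ 2c + O(1)`; everything else is `poly(n)`).
* Every `NTIME` membership asserted or to be proved here (`L ∈ NTIME williamsBound` in
  Thm. 3.2, the clause-checking verifier behind 5.2 ⟹ 5.1, `P ⊆ NTIME(2ⁿ)`, the padding fact)
  lives in the tree's verifier form with ONE constant for witness length and time
  (`Nondeterministic.lean`); the verifier therefore reads the unused part of a maximal witness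
  two symbols per step — the truncating wrapper `truncMapAux` of `TruncMapMachine.lean` is the
  tree's tool for exactly this.
* `ACC0` bounds gates (`Circuit.size`), Williams bounds wires; see `Williams2014.lean`.

## References

* R. Williams, *Nonuniform ACC circuit lower bounds*, J. ACM 61(1) (2014) 2:1–2:32, Thm. 1.1,
  Thm. 1.3, §2, Fact 3.1, Thm. 3.3, Lemma 3.1, Thm. 3.2, §5: Thm. 5.1, Thm. 5.2, Lemma 5.1,
  proof of Thm. 1.1 (pp. 17–18) [Williams2014].
* R. Impagliazzo, V. Kabanets, A. Wigderson, *In search of an easy witness: exponential time vs.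
  probabilistic polynomial time*, JCSS 65 (2002) 672–694 [ImpagliazzoKabanetsWigderson2002].
* L. Fortnow, R. Lipton, D. van Melkebeek, A. Viglas, *Time-space lower bounds for
  satisfiability*, J. ACM 52 (2005) 835–865 [FortnowEtAl2005]; I. Tourlakis, *Time-space
  tradeoffs for SAT on nonuniform machines*, JCSS 63 (2001).
* S. Arora, B. Barak, *Computational Complexity: A Modern Approach*, CUP 2009, Claim 2.4,
  §2.6.2, §6.1, Thm. 3.2 [AroraBarak2009].
-/

namespace Literature.Computability.Complexity

open _root_.Computability Turing Filter Asymptotics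

/-! ### Assignments encoded by circuits -/

/-- The assignment to the variables `ℕ` encoded by a circuit `W` on `k` inputs: variable `v < 2ᵏ`
gets the value of `W` at the `v`-th point of `{0,1}ᵏ` in the tree's standard enumeration
(`MetaComplexity.boolFunEquivFin`, least significant bit first), larger variables get `false`
(Williams 2014, Fact 3.2 / §5: "the variable assignment `zᵢ = W(i)` for all `i = 1, …, 2ᵏ`").
[cite: Williams2014, Fact 3.2] -/
def Circuit.assignment {k : ℕ} (W : Circuit (Fin k)) (v : ℕ) : Bool :=
  if h : v < 2 ^ k then W.eval ((MetaComplexity.boolFunEquivFin k).symm ⟨v, h⟩) else false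

/-- Unfolding `Circuit.assignment` below `2 ^ k`. [folklore] -/
theorem Circuit.assignment_of_lt {k : ℕ} (W : Circuit (Fin k)) {v : ℕ} (hv : v < 2 ^ k) :
    W.assignment v = W.eval ((MetaComplexity.boolFunEquivFin k).symm ⟨v, hv⟩) := by
  simp [Circuit.assignment, hv]

/-- `Circuit.assignment` vanishes from `2 ^ k` on. [folklore] -/
theorem Circuit.assignment_of_le {k : ℕ} (W : Circuit (Fin k)) {v : ℕ} (hv : 2 ^ k ≤ v) :
    W.assignment v = false := by
  simp [Circuit.assignment, Nat.not_lt.2 hv]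

/-- The assignment encoded by `W` is the tree's truth table of `W` read bitwise:
`W.assignment v = (truthTable W.eval)[v]` for `v < 2 ^ k` (`MetaComplexity.truthTable`; Williams
2014, §3: "the bit string obtained by evaluating `W` on all possible assignments").
[cite: Williams2014, §3] -/
theorem Circuit.assignment_eq_getElem_truthTable {k : ℕ} (W : Circuit (Fin k)) {v : ℕ}
    (hv : v < (MetaComplexity.truthTable W.eval).length) :
    W.assignment v = (MetaComplexity.truthTable W.eval)[v] := by
  have hv' : v < 2 ^ k := by simpa using hv
  simp [Circuit.assignment, hv', MetaComplexity.truthTable]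

/-! ### Succinctly presented `3CNF` formulas and succinct reductions -/

/-- The index width `n + c · log₂ n + c` of a succinct reduction with constant `c` on inputs of
length `n`: clause indices and variable indices are `< 2 ^ (n + c log₂ n + c)`, i.e. the formula
has `2ⁿ · poly(n)` clauses (Williams 2014, Fact 3.1: "at most `n + c log n` inputs",
"`F_{Cₓ}` of `2ⁿ · poly(n)` size"; `log₂ = Nat.log 2`, the additive `c` absorbs rounding).
[cite: Williams2014, Fact 3.1] -/
def succinctWidth (c n : ℕ) : ℕ := n + c * Nat.log 2 n + c

/-- `n ≤ succinctWidth c n`. [folklore] -/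
theorem le_succinctWidth (c n : ℕ) : n ≤ succinctWidth c n :=
  (Nat.le_add_right n _).trans (Nat.le_add_right _ c)

/-- The formula presented by a clause function `cl` on input `x` with constant `c`: the clauses
`cl x i` for `i < 2 ^ succinctWidth c |x|`, as a `CNF ℕ` (Williams 2014, §3: the *decompression*
`F_C` of a succinct `3SAT` instance, "the `2ⁿ`-bit instance of 3-SAT obtained by evaluating `C`
on all of its possible inputs in lexicographical order"). [cite: Williams2014, §3] -/
def succinctCNF (c : ℕ) (cl : List Bool → ℕ → Clause ℕ) (x : List Bool) : CNF ℕ :=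
  (List.range (2 ^ succinctWidth c x.length)).map (cl x)

/-- The number of clauses of `succinctCNF c cl x` is `2 ^ succinctWidth c |x|`. [folklore] -/
@[simp] theorem length_succinctCNF (c : ℕ) (cl : List Bool → ℕ → Clause ℕ) (x : List Bool) :
    (succinctCNF c cl x).length = 2 ^ succinctWidth c x.length := by
  simp [succinctCNF]

/-- Membership in `succinctCNF`. [folklore] -/
theorem mem_succinctCNF_iff {c : ℕ} {cl : List Bool → ℕ → Clause ℕ} {x : List Bool}
    {C : Clause ℕ} : C ∈ succinctCNF c cl x ↔ ∃ i < 2 ^ succinctWidth c x.length, cl x i = C := by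
  simp [succinctCNF]

/-- `succinctCNF c cl x` is true under `σ` iff every clause `cl x i`,
`i < 2 ^ succinctWidth c |x|`, is. [folklore] -/
theorem eval_succinctCNF_eq_true_iff {c : ℕ} {cl : List Bool → ℕ → Clause ℕ} {x : List Bool}
    {σ : ℕ → Bool} : (succinctCNF c cl x).eval σ = true ↔
      ∀ i < 2 ^ succinctWidth c x.length, (cl x i).eval σ = true := by
  simp [succinctCNF, CNF.eval, Clause.eval]

/-- The string presentation of a clause query `(x, i)`: the pair `⟨x, bin i⟩` (`boolPair`,
Mathlib's `encodeNat`). [folklore] -/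
def encodeClauseQuery (p : List Bool × ℕ) : List Bool := boolPair p.1 (encodeNat p.2)

/-- `encodeClauseQuery` is injective. [folklore] -/
theorem encodeClauseQuery_injective : Function.Injective encodeClauseQuery := by
  rintro ⟨x, i⟩ ⟨x', i'⟩ h
  have h' := congr_arg boolUnpair h
  simp only [encodeClauseQuery, boolUnpair_boolPair, Prod.mk.injEq] at h'
  obtain ⟨rfl, hi⟩ := h'
  have := congr_arg decodeNat hi
  rw [decode_encodeNat, decode_encodeNat] at this
  subst this
  rfl

/-- **Succinct reductions to `3SAT`** (the data produced by Williams 2014, Fact 3.1 / Thm. 3.3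
for a language `L`, with constant `c`): a clause function `cl` such that every clause `cl x i`
has at most `3` literals, on variables `< 2 ^ (n + c log₂ n + c)` (`n = |x|`); the map
`⟨x, bin i⟩ ↦ code (cl x i)` is computable in time `a · ℓᶜ + a`, `ℓ` the length of the query
`⟨x, bin i⟩` (Mathlib `TM2`, the tree's `TimeComputable`, clause code `encodingClause` of
`CNF.lean`) — a polynomial bound whose EXPONENT is the universal constant `c`, as in the printed
"a circuit `Cₓ` with at most `n + c log n` inputs and `O(nᶜ)` size" (the uniform exponent is what
Lemma 3.1 needs: the gate indices of `Cₓ` have `O(c log n)` bits), the constant `a` depending on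
`L`; and `x ∈ L` iff the presented formula `succinctCNF c cl x` (clauses
`i < 2 ^ (n + c log₂ n + c)`) is satisfiable. (For `c = 0` the time field is unsatisfiable — a
constant time bound cannot consume unboundedly long queries, cf. the halting rule of
`TimeBounds.lean` — which is harmless: every use quantifies `c` existentially or universally.)
[cite: Williams2014, Fact 3.1 and Thm. 3.3] -/
structure IsSuccinctReduction (c : ℕ) (L : Language Bool) (cl : List Bool → ℕ → Clause ℕ) :
    Prop where
  /-- `3CNF`: every clause has at most three literals. -/
  length_le : ∀ (x : List Bool) (i : ℕ), (cl x i).length ≤ 3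
  /-- Variable indices have at most `n + c log₂ n + c` bits. -/
  var_lt : ∀ (x : List Bool) (i : ℕ), ∀ l ∈ cl x i, l.1 < 2 ^ succinctWidth c x.length
  /-- The `i`-th clause is computable from `⟨x, bin i⟩` in time `a · ℓᶜ + a`. -/
  time : ∃ a : ℕ, TimeComputable encodeClauseQuery encodingClause.encode (Function.uncurry cl)
    fun ℓ => a * ℓ ^ c + a
  /-- Correctness: `x ∈ L` iff the presented formula is satisfiable. -/
  mem_iff : ∀ x : List Bool, x ∈ L ↔ (succinctCNF c cl x).Satisfiable

/-- The clause function of a succinct reduction is polynomial-time computable (on `⟨x, bin i⟩`).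
[cite: Williams2014, Fact 3.1] -/
theorem IsSuccinctReduction.polyTimeComputable {c : ℕ} {L : Language Bool}
    {cl : List Bool → ℕ → Clause ℕ} (h : IsSuccinctReduction c L cl) :
    PolyTimeComputable encodeClauseQuery encodingClause.encode (Function.uncurry cl) := by
  obtain ⟨a, ha⟩ := h.time
  refine ⟨Polynomial.C a * Polynomial.X ^ c + Polynomial.C a, ?_⟩
  convert ha using 2 with ℓ
  simp

/-- **Succinct satisfying assignments** (Williams 2014, §5, p. 17: "SUCCINCT 3SAT has succinct
satisfying assignments if there is a fixed constant `c` such that for every language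
`L ∈ NTIME[2ⁿ]` and every `x ∈ L` of length `n`, there is a circuit `Wₓ` of `poly(n)` size with
`k ≤ n + c log n` inputs such that the variable assignment `zᵢ = W(i)` for all `i = 1, …, 2ᵏ` is
a satisfying assignment for the formula `F_{Cₓ}`"), relative to a succinct reduction `cl` of `L`
with constant `c`: there is an exponent `e` such that for every `x ∈ L` some `B₂`-circuit `W`
with `k ≤ n + c log₂ n + c` inputs and at most `nᵉ + e` gates encodes (`Circuit.assignment`) a
satisfying assignment of `succinctCNF c cl x`. [cite: Williams2014, §5 (p. 17) and Fact 3.2] -/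
def HasSuccinctAssignments (c : ℕ) (L : Language Bool) (cl : List Bool → ℕ → Clause ℕ) : Prop :=
  ∃ e : ℕ, ∀ x ∈ L, ∃ (k : ℕ) (W : Circuit (Fin k)), k ≤ succinctWidth c x.length ∧
    W.IsOver B2 ∧ W.size ≤ x.length ^ e + e ∧ (succinctCNF c cl x).eval W.assignment = true

/-- Sanity: a succinct satisfying assignment satisfies the presented formula. [folklore] -/
theorem HasSuccinctAssignments.satisfiable {c : ℕ} {L : Language Bool}
    {cl : List Bool → ℕ → Clause ℕ} (h : HasSuccinctAssignments c L cl) {x : List Bool}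
    (hx : x ∈ L) : (succinctCNF c cl x).Satisfiable := by
  obtain ⟨e, he⟩ := h
  obtain ⟨k, W, -, -, -, hW⟩ := he x hx
  exact ⟨W.assignment, hW⟩

/-! ### Verifiers and universal witness circuits -/

/-- The data of `L ∈ NTIME t` (`Nondeterministic.lean`): a constant `c`, a relation `rel` and a
`TM2` machine computing `rel x y` on `⟨x, y⟩` within `c * t |x| + c` steps for every witness in
the length bound `|y| ≤ c * t |x| + c`, such that `x ∈ L ↔ ∃ y, |y| ≤ c * t |x| + c ∧ rel x y` —
a *correct `t`-time verifier for `L`* (Williams 2014, §5: "every correct exponential time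
verifier for `L`"; Arora–Barak 2009, Def. 2.1). [cite: Williams2014, §5] -/
structure NVerifier (t : ℕ → ℕ) (L : Language Bool) where
  /-- The constant of the `O`-bounds. -/
  c : ℕ
  /-- The verification relation. -/
  rel : List Bool → List Bool → Bool
  /-- The verifying machine. -/
  machine : TM2ComputableAux Bool Bool
  /-- Running time on witnesses inside the length bound. -/
  outputsWithin : ∀ x y : List Bool, y.length ≤ c * t x.length + c →
    machine.OutputsWithin (boolPair x y) (encodeBool (rel x y)) (c * t x.length + c)
  /-- Correctness. -/
  mem_iff : ∀ x : List Bool, x ∈ L ↔ ∃ y : List Bool, y.length ≤ c * t x.length + c ∧ rel x y = true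

/-- `L ∈ NTIME t` iff `L` has a correct `t`-time verifier (definitional repackaging).
[cite: AroraBarak2009, Def. 2.1] -/
theorem mem_NTIME_iff_nonempty_nVerifier {t : ℕ → ℕ} {L : Language Bool} :
    L ∈ NTIME t ↔ Nonempty (NVerifier t L) :=
  ⟨fun ⟨c, R, M, hM, hL⟩ => ⟨⟨c, R, M, hM, hL⟩⟩,
    fun ⟨V⟩ => ⟨V.c, V.rel, V.machine, V.outputsWithin, V.mem_iff⟩⟩

/-- **Universal witness circuits** (Williams 2014, §5, after Impagliazzo–Kabanets–Wigderson
2002: "`NEXP` has universal witness circuits of polynomial size if for every `L ∈ NEXP` and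
every correct exponential time verifier for `L`, there is a `c > 0` such that for every `x ∈ L`,
there is a circuit of size at most `|x|ᶜ + c` which encodes a witness for `x` that is accepted by
the verifier"). For the language `L`: for every exponent `k` and every correct `2^{nᵏ}`-time
verifier `V` for `L` there is `c` such that every `x ∈ L` has a witness `y` accepted by `V`
(inside `V`'s length bound) which is a prefix of the truth table (the tree's
`MetaComplexity.truthTable`) of a `B₂`-circuit with at most `|x|ᶜ + c` gates.
[cite: Williams2014, §5 (before Thm. 5.2)] -/
def HasUniversalWitnessCircuits (L : Language Bool) : Prop :=
  ∀ (k : ℕ) (V : NVerifier (fun n => 2 ^ (n ^ k)) L), ∃ c : ℕ, ∀ x ∈ L,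
    ∃ (m : ℕ) (W : Circuit (Fin m)) (y : List Bool), W.IsOver B2 ∧ W.size ≤ x.length ^ c + c ∧
      y.length ≤ V.c * 2 ^ (x.length ^ k) + V.c ∧ V.rel x y = true ∧
        y <+: MetaComplexity.truthTable W.eval

/-! ### The vendored facts -/

/-- **Williams 2014, Fact 3.1** (efficient succinct Cook–Levin reduction; from Thm. 3.3 =
Tourlakis 2001, Fortnow–Lipton–van Melkebeek–Viglas 2005, by padding): "There is a constant
`c > 0` such that for every `L ∈ NTIME[2ⁿ]`, there is a reduction from `L` to SUCCINCT 3SAT which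
on input `x` of length `n` runs in `poly(n)` time and produces a circuit `Cₓ` with at most
`n + c log n` inputs and `O(nᶜ)` size, such that `x ∈ L` if and only if the decompressed formula
`F_{Cₓ}` of `2ⁿ · poly(n)` size is satisfiable"; Thm. 3.3: "there is an algorithm … that, given an
instance of `L` … and an integer `i` … in binary …, outputs the `i`th clause of the resulting 3SAT
formula". Vendored in the clause-function form (`IsSuccinctReduction`: the `i`-th clause is
computable from `⟨x, bin i⟩` in time `O(ℓᶜ)`, `2 ^ (n + c log₂ n + c)` clauses of width `≤ 3` on
as many variables), for the tree's verifier-form `NTIME` over `TM2` (see the module docstring,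
"Faithfulness notes"). [cite: Williams2014, Fact 3.1 and Thm. 3.3] -/
def Williams2014_fact_3_1 : Prop :=
  ∃ c : ℕ, ∀ L ∈ NTIME (fun n => 2 ^ n), ∃ cl : List Bool → ℕ → Clause ℕ,
    IsSuccinctReduction c L cl

/-- **Williams 2014, Thm. 5.2** (Impagliazzo–Kabanets–Wigderson 2002; Williams 2010): "If
`NEXP ⊆ P/poly` then every language in `NEXP` has universal witness circuits of polynomial size."
Over the tree's `NEXP`, `PPoly` and verifier-form `NTIME` (`HasUniversalWitnessCircuits`).
Printed proof: the easy-witness method (if some verifier has, infinitely often, only witnesses of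
high circuit complexity, these derandomise `MA ⊇ EXP` into `i.o.-NTIME[2^{n^ε}]/n`, contradicting
`NEXP ⊆ P/poly` by diagonalization). Related leaf: the tree already vendors the IKW COROLLARY
`NEXP_eq_EXP_of_subset_PPoly` (`ExpTimeCollapses.lean`; `NEXP ⊆ P/poly → NEXP = EXP`), which
follows from this universal-witness statement by one more machine construction (exhaustive
search over witness circuits); the two leaves are not interderivable inside the tree yet.
[cite: Williams2014, Thm. 5.2] -/
def Williams2014_thm_5_2 : Prop :=
  NEXP ⊆ PPoly → ∀ L ∈ NEXP, HasUniversalWitnessCircuits L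

/-- **Williams 2014, Thm. 5.1** ([Wil10]; "follows immediately from" Thm. 5.2): "Suppose `NEXP`
has polynomial size circuits. Then SUCCINCT 3SAT has succinct satisfying assignments." Stated for
every succinct reduction `cl` (constant `c`) of a language `L ∈ NTIME[2ⁿ]`: under
`NEXP ⊆ P/poly`, `HasSuccinctAssignments c L cl`. The printed statement concerns the reduction of
Fact 3.1; the printed derivation from Thm. 5.2 — apply universal witness circuits to the correct
exponential-time verifier "`y` satisfies every clause `cl x i`" — is the same for every succinct
reduction (module docstring). The hypothesis `L ∈ NTIME (2 ^ ·)` is not needed by that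
derivation (the clause-checking verifier built from `IsSuccinctReduction.time` puts `L` in
`NEXP` by itself, cf. `NTIME_two_pow_subset_NEXP`); it is kept deliberately, as the printed
scope "for every language `L ∈ NTIME[2ⁿ]`" and as what the assembly supplies.
[cite: Williams2014, Thm. 5.1] -/
def Williams2014_thm_5_1 : Prop :=
  NEXP ⊆ PPoly → ∀ (c : ℕ) (L : Language Bool) (cl : List Bool → ℕ → Clause ℕ),
    L ∈ NTIME (fun n => 2 ^ n) → IsSuccinctReduction c L cl → HasSuccinctAssignments c L cl

/-- The sub-`2ⁿ` nondeterministic time bound reached by Williams' simulation: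
`williamsBound n = n + 2ⁿ / n` (natural division; `2⁰ / 0 = 0`). The summand `n` keeps the bound
time-constructible in the tree's sense (`n ≤ t n`); `williamsBound (n + 1) = o(2ⁿ)`
(`isLittleO_williamsBound_succ`). (Williams 2014, §1.1 and proof of Thm. 3.2: "every
`L ∈ NTIME[2ⁿ]` can be accepted by a nondeterministic algorithm in `O(2ⁿ n¹⁰/nᵏ)` time".)
[cite: Williams2014, §1.1] -/
def williamsBound (n : ℕ) : ℕ := n + 2 ^ n / n

/-- `n ≤ williamsBound n`. [folklore] -/
theorem le_williamsBound (n : ℕ) : n ≤ williamsBound n := Nat.le_add_right n _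

/-- `williamsBound n ≤ n + 2 ^ n`. [folklore] -/
theorem williamsBound_le (n : ℕ) : williamsBound n ≤ n + 2 ^ n :=
  Nat.add_le_add_left (Nat.div_le_self _ _) n

/-- **`williamsBound` is time constructible** (`WilliamsBoundConstructible.lean`,
`isTimeConstructible_id_add_two_pow_div`: `1ⁿ ↦ bin (n + 2ⁿ / n)` by polynomial-time bricks, and
every polynomial is `≤ c · (n + 2ⁿ / n) + c`). [cite: AroraBarakCC2009, §1.3 (p. 16)] -/
theorem isTimeConstructible_williamsBound : IsTimeConstructible williamsBound :=
  isTimeConstructible_id_add_two_pow_div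

/-- **Williams 2014, Thm. 3.2 with Lemma 3.1, polynomial-size form** (the nondeterministic
simulation, as rerun in the proof of Thm. 1.1, p. 18). For every constant `c` there is an exponent
`k` such that for every language `L` with a succinct reduction `cl` of constant `c`: if `L` has
succinct satisfying assignments relative to `cl` (Fact 3.2 / Thm. 5.1), `P ⊆ ACC0` (so that, by
Lemma 3.1, an `ACC` circuit equivalent to `Cₓ` can be guessed and verified with `ACC`-SAT calls,
and, by Lemma 5.1, the witness circuits have equivalent polynomial-size `ACC` circuits), and
satisfiability of `AC⁰[m]` circuits of depth `d` with at most `nᵉ + e` gates of fan-in `≤ nᵉ + e`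
on `n` inputs is decidable in `O(2ⁿ/nᵏ)` deterministic time for all `d`, `m ≥ 2`, `e`
(`AccSatInTime`, `Williams2014.lean`), then `L ∈ NTIME (n + 2ⁿ/n)` (`williamsBound`; verifier
form over `TM2`: guess the `ACC` circuits `Cₓ'`, `D`, `E` of Lemma 3.1 and the witness circuit
`W`, verify them and the unsatisfiability of the circuit `D` of Thm. 3.2 with three SAT calls on
circuits with `n + 2c log₂ n + O(1)` inputs; printed: "`B` decides if `x ∈ L` in `O(2ⁿ/nᶜ)`
time"). [cite: Williams2014, Thm. 3.2, Lemma 3.1 and proof of Thm. 1.1] -/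
def Williams2014_thm_3_2 : Prop :=
  ∀ c : ℕ, ∃ k : ℕ, ∀ (L : Language Bool) (cl : List Bool → ℕ → Clause ℕ),
    IsSuccinctReduction c L cl → HasSuccinctAssignments c L cl → Classes.P ⊆ ACC0 →
      (∀ d m e : ℕ, 2 ≤ m → AccSatInTime d m (fun n => n ^ e + e) (fun n => 2 ^ n / n ^ k)) →
        L ∈ NTIME williamsBound

/-! ### The padding step (named fact; a machine construction) -/

/-- **Padding** `NTIME(2ⁿ) ⊆ P/poly → NEXP ⊆ P/poly` (translation as in Arora–Barak 2009,
§2.6.2, proof of Thm. 2.22; Williams 2014, proof of Thm. 1.1, p. 17: "if `NTIME[2ⁿ]` has polysize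
`ACC` circuits, then every language in `NEXP` has polysize `ACC` circuits"): for
`L ∈ NTIME(2^{nʲ})` a polynomially padded version of `L` is in `NTIME(2ⁿ)`, hence in `P/poly`,
and `P/poly` is closed under the polynomial-time padding map (`mem_PPoly_of_karpReducible`,
`PPolyReductions.lean`). Named fact (machine construction). [cite: AroraBarak2009, §2.6.2 (Thm. 2.22)] -/
def NEXP_subset_PPoly_of_NTIME_two_pow_subset : Prop :=
  NTIME (fun n => 2 ^ n) ⊆ PPoly → NEXP ⊆ PPoly

/-- `ACC⁰ ⊆ P/poly` through the chain `ACC⁰ ⊆ TC⁰ ⊆ NC¹ ⊆ P/poly` of `ConstantDepth.lean`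
(named facts `ACC0_subset_TC0`, `TC0_subset_NC1`; theorem `NC1_subset_PPoly`): the alternative
to the direct proof `ACC0_subset_PPoly` of `ACC0SubsetPPoly.lean` for the hypothesis
`ACC0 ⊆ PPoly` of the assembly below (Arora–Barak 2009, §14.4; Vollmer 1999, §4).
[cite: AroraBarak2009, §6.1 and Def. 14.4] -/
theorem ACC0_subset_PPoly_of_chain (h₁ : ACC0_subset_TC0) (h₂ : TC0_subset_NC1) :
    ACC0 ⊆ PPoly :=
  fun _ hL => NC1_subset_PPoly (h₂ (h₁ hL))

/-! ### Proved: elementary properties and the assembly of Theorem 1.3 -/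

/-- `NTIME(2ⁿ) ⊆ NEXP` (the member `k = 1` of the union, `2 ^ (n ^ 1) = 2 ^ n`).
[cite: AroraBarak2009, §2.6.2] -/
theorem NTIME_two_pow_subset_NEXP : NTIME (fun n => 2 ^ n) ⊆ NEXP := by
  intro L hL
  simp only [NEXP, Set.mem_iUnion]
  refine ⟨1, ?_⟩
  simpa only [pow_one] using hL

/-- `AccSatInTime` with the time bound `2ⁿ / n^(k+1)` implies it with `2ⁿ / nᵏ` (the former is
pointwise smaller). [folklore] -/
theorem AccSatInTime.of_pow_succ {d m k : ℕ} {s : ℕ → ℕ}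
    (h : AccSatInTime d m s (fun n => 2 ^ n / n ^ (k + 1))) :
    AccSatInTime d m s (fun n => 2 ^ n / n ^ k) := by
  refine h.of_le_of_bdd 0 0 (fun n _ => ?_) (fun n hn => absurd hn (Nat.not_lt_zero n))
  rcases Nat.eq_zero_or_pos n with rfl | hn
  · simp
  · exact Nat.div_le_div_left (Nat.pow_le_pow_right hn (Nat.le_succ k)) (Nat.pow_pos hn)

/-- `williamsBound (n + 1) = o(2ⁿ)`: indeed `williamsBound (n + 1) ≤ (n + 1) + 2 · 2ⁿ/(n + 1)`
and both `(n + 1)/2ⁿ` and `2/(n + 1)` tend to `0` — the side condition `f(n + 1) = o(g(n))` of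
the nondeterministic time hierarchy theorem (Arora–Barak 2009, Thm. 3.2) for `f = williamsBound`,
`g = 2ⁿ`. [folklore] -/
theorem isLittleO_williamsBound_succ :
    (fun n => (williamsBound (n + 1) : ℝ)) =o[atTop] fun n => ((2 ^ n : ℕ) : ℝ) := by
  have h2 : ∀ n : ℕ, ((2 ^ n : ℕ) : ℝ) = (2 : ℝ) ^ n := fun n => by simp
  simp_rw [h2]
  refine (isLittleO_iff_tendsto' (Eventually.of_forall fun n h => ?_)).2 ?_
  · exact absurd h (pow_ne_zero n two_ne_zero)
  -- squeeze `williamsBound (n+1) / 2^n` between `0` and `(n+1)/2^n + 2/(n+1)`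
  have hb : ∀ n : ℕ, (williamsBound (n + 1) : ℝ) / 2 ^ n ≤
      ((n + 1 : ℕ) : ℝ) / 2 ^ n + 2 / ((n + 1 : ℕ) : ℝ) := by
    intro n
    have hpos : (0 : ℝ) < 2 ^ n := pow_pos two_pos n
    have hn1 : (0 : ℝ) < ((n + 1 : ℕ) : ℝ) := by positivity
    have hq : ((2 ^ (n + 1) / (n + 1) : ℕ) : ℝ) * ((n + 1 : ℕ) : ℝ) ≤ 2 ^ n * 2 := by
      have h1 : ((2 ^ (n + 1) / (n + 1) * (n + 1) : ℕ) : ℝ) ≤ ((2 ^ (n + 1) : ℕ) : ℝ) := by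
        exact_mod_cast Nat.div_mul_le_self (2 ^ (n + 1)) (n + 1)
      have h3 : ((2 ^ (n + 1) : ℕ) : ℝ) = 2 ^ n * 2 := by simp [pow_succ]
      rw [← h3]
      simpa [Nat.cast_mul] using h1
    have hw : (williamsBound (n + 1) : ℝ) =
        ((n + 1 : ℕ) : ℝ) + ((2 ^ (n + 1) / (n + 1) : ℕ) : ℝ) := by
      simp [williamsBound]
    have hle : (williamsBound (n + 1) : ℝ) ≤ ((n + 1 : ℕ) : ℝ) + 2 * 2 ^ n / ((n + 1 : ℕ) : ℝ) := by
      rw [hw, add_le_add_iff_left, le_div_iff₀ hn1]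
      linarith [hq]
    calc (williamsBound (n + 1) : ℝ) / 2 ^ n
        ≤ (((n + 1 : ℕ) : ℝ) + 2 * 2 ^ n / ((n + 1 : ℕ) : ℝ)) / 2 ^ n :=
          div_le_div_of_nonneg_right hle hpos.le
      _ = ((n + 1 : ℕ) : ℝ) / 2 ^ n + 2 / ((n + 1 : ℕ) : ℝ) := by
          field_simp
  have h0 : ∀ n : ℕ, 0 ≤ (williamsBound (n + 1) : ℝ) / 2 ^ n := fun n => by positivity
  refine squeeze_zero h0 hb ?_
  rw [← add_zero (0 : ℝ)]
  refine Tendsto.add ?_ ?_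
  · -- `(n+1)/2^n → 0`, from `m / 2^m → 0` shifted by one and doubled
    have h := tendsto_pow_const_div_const_pow_of_one_lt 1 (one_lt_two (α := ℝ))
    have h' := ((tendsto_add_atTop_iff_nat 1).2 h).const_mul 2
    rw [mul_zero] at h'
    refine h'.congr' (Eventually.of_forall fun n => ?_)
    rw [pow_one, pow_succ]
    field_simp
  · -- `2/(n+1) → 0`
    have h := tendsto_const_div_atTop_nhds_zero_nat (2 : ℝ)
    have h' := (tendsto_add_atTop_iff_nat 1).2 h
    refine h'.congr' (Eventually.of_forall fun n => ?_)
    simp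

/-- **Assembly of Williams' Theorem 1.3 (for `ACC`) from its printed components**: the succinct
Cook–Levin reduction (Fact 3.1), succinct satisfying assignments under `NEXP ⊆ P/poly`
(Thm. 5.1, from IKW's Thm. 5.2), the nondeterministic simulation (Thm. 3.2 with Lemma 3.1), the
nondeterministic time hierarchy theorem (`ntime_hierarchy`), the inclusion `ACC⁰ ⊆ P/poly`
(hypothesis; `ACC0_subset_PPoly` of `ACC0SubsetPPoly.lean` or `ACC0_subset_PPoly_of_chain`) and
the padding step `NTIME(2ⁿ) ⊆ P/poly → NEXP ⊆ P/poly` imply `Williams2014_lowerBound_of_accSat`;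
the tree's theorems `P ⊆ NTIME(2ⁿ)` (`P_subset_NTIME_two_pow_thm`), `isTimeConstructible_williamsBound`
and `isTimeConstructible_two_pow` are used (Williams 2014, proof of Thm. 1.1, pp. 17–18: assuming
`NTIME[2ⁿ] ⊆ ACC`, "every language in `NEXP` has polysize `ACC` circuits", "by Lemma 5.1 and
Theorem 5.1 … SUCCINCT 3SAT has succinct satisfying assignments", "the desired contradiction
follows from the nondeterministic time hierarchy"). [cite: Williams2014, Thm. 1.3 and proof of Thm. 1.1] -/
theorem Williams2014_lowerBound_of_accSat_of (h31 : Williams2014_fact_3_1)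
    (h51 : Williams2014_thm_5_1) (h32 : Williams2014_thm_3_2) (hH : ntime_hierarchy)
    (hA : ACC0 ⊆ PPoly) (hE : NEXP_subset_PPoly_of_NTIME_two_pow_subset) :
    Williams2014_lowerBound_of_accSat := by
  obtain ⟨c, hc⟩ := h31
  obtain ⟨k, hk⟩ := h32 c
  refine ⟨k + 1, Nat.succ_pos k, fun hsat hsub => ?_⟩
  have hPacc : Classes.P ⊆ ACC0 := fun L hL => hsub (P_subset_NTIME_two_pow_thm hL)
  have hNEXP : NEXP ⊆ PPoly := hE fun L hL => hA (hsub hL)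
  have hincl : NTIME (fun n => 2 ^ n) ⊆ NTIME williamsBound := fun L hL => by
    obtain ⟨cl, hcl⟩ := hc L hL
    exact hk L cl hcl (h51 hNEXP c L cl hL hcl) hPacc fun d m e hm => (hsat d m e hm).of_pow_succ
  exact hH williamsBound (fun n => 2 ^ n) isTimeConstructible_williamsBound
    TimeConstructible.isTimeConstructible_two_pow isLittleO_williamsBound_succ hincl

/-- The same assembly one level up: together with the `ACC`-SAT algorithm of Thm. 4.1
(`Williams2014_accSat_polysize`) the components yield `williams_acc : ¬ (NTIME (2 ^ ·) ⊆ ACC0)`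
(`williams_acc_of_Williams2014`, `Williams2014.lean`).
[cite: Williams2014, Thm. 1.1 and its proof] -/
theorem williams_acc_of_components (h31 : Williams2014_fact_3_1) (h51 : Williams2014_thm_5_1)
    (h32 : Williams2014_thm_3_2) (hH : ntime_hierarchy) (hA : ACC0 ⊆ PPoly)
    (hE : NEXP_subset_PPoly_of_NTIME_two_pow_subset) (h41 : Williams2014_accSat_polysize) :
    williams_acc :=
  williams_acc_of_Williams2014 (Williams2014_lowerBound_of_accSat_of h31 h51 h32 hH hA hE) h41

end Literature.Computability.Complexity
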